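import Summits.NavierStokesRegularity.NavierStokesRegularity.Theorems.EulerZoomLiouvillePowerGaugeEulerLiouvilleNeedleFastSetMeasure

/-!
(PART 2/2 of nsreg-p2 g33's plate t39c-C `…NeedleFastSetMeasure.lean`, sha16 42e9641f75b41295, 482 l. > the 400-line rule: split at the gate by the firing
seat ns-ezl-w7 g0 — part 1/2 `…NeedleFastSetMeasure.lean` = §§1–3 (chart budgets, good radii, tubes); THIS FILE = §4 the structural theorem; same
namespace, declarations byte-identical.)
# Thin fast exits WITHOUT SYMMETRY — structural part: good radii, the six chart tubes, the cover
# (plate t39c-C of ROUND-38 «the waiting-time exponent»; crux E `PowerGaugeEulerLiouville`,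
# stmt-NavierStokesRegularity-19832)

LANDING PLATE prepared by nsreg-p2 g33 (TEXT custody, DIRECTOR-NS #199 (1)) for a keyed PROVER hand
(`--supports stmt-NavierStokesRegularity-19832 --as helper`).  No Euler content, NO SYMMETRY.

For a `C¹` field `U` on `ℝ³`, a threshold `γ > 0`, a dyadic scale `R ≥ 1` with ball budgets
`∫_{B_{2R}} ‖U‖² ≤ B_A`, `∫_{B_{2R}} ‖DU‖² ≤ B_E`, and a band number `J ≥ 1` admissible for the band law uniformly over
the radii `t ∈ (R, 2R)`:
* GOOD RADII (`goodRadii`): the radii at which the two chart energies of a frame (`chartBudget`, over the chart disc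
  `‖z‖ < 9t/10`) stay below `𝒜 = 48(B_A+1)/R`, `ℰ = 48(B_E+1)/R`; by the cone Tonelli of ROUND-36 and Chebyshev the
  bad radii of one frame have measure `≤ R/24` (`volume_Ioo_diff_goodRadii_le`), so the radii good for all SIX signed
  frames have measure `≥ 3R/4`;
* TUBES (`tube`): the `γ`-fast points of the aperture-`17/20` sector of a frame over the good radii; by the REVERSE
  cone Tonelli (`NeedleSectorTonelli.lintegral_sector_le`) and the per-chart decay (`NeedleChartFastArea.chart_fastArea_le`)
  `|tube| ≤ 8𝒜e^{−J/4}/(γ²R)·` (`volume_tube_le`);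
* `thinFastExits_structural`: with `G = {t² : t good for all six frames}` (`|G| ≥ R²`) and `N =` the union of the six
  tubes, every `γ`-fast `y` with `‖y‖² ∈ G` lies in `N ⊆ B_{2R}` (six-cone cover `exists_inner_sq_ge` +
  `mem_sector_of_inner_sq`) and `|N|·∫_N ‖U‖² ≤ 48·𝒜·B_A·e^{−J/4}/(γ²R)`.
The asymptotic choice of `J` (part D, `…NeedleThinFastExits.lean`) turns this into the `hthin` hypothesis of
`NeedleRace.curl_eq_zero_of_thinFastExits` for every `m` — t38j-C's `NeedleAxisymBand.thinFastExits` minus `IsAxisymmetric`.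
[folklore: Chebyshev, Tonelli, pigeonhole; the decay is the band law of plate t39b]
-/

set_option linter.dupNamespace false

open MeasureTheory Set Metric Real
open scoped RealInnerProductSpace ENNReal

namespace Summit.NavierStokesRegularity.NavierStokesRegularity.Theorems.PowerGaugeEulerLiouville.NeedleFastSetMeasure

open NeedleDiscChart NeedleSphereChart NeedleThinness NeedleSphereThinness NeedleSphericalTonelli NeedleBandTest NeedleBandLaw
  NeedleChartFastArea NeedleSectorTonelli NeedleAxisymBand

variable {e e₁ e₂ : (EuclideanSpace ℝ (Fin 3))} {U : (EuclideanSpace ℝ (Fin 3)) → (EuclideanSpace ℝ (Fin 3))}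


/-! ## 4. The structural theorem: six frames, good radii for all, the squares, the union of the tubes -/

/-- **THIN FAST EXITS — STRUCTURAL FORM (no symmetry).**  `U ∈ C¹(ℝ³; ℝ³)`, an orthonormal frame `u, u₁, u₂`,
`γ > 0`, `R > 0`, ball budgets `∫_{B_{2R}} ‖U‖² ≤ B_A`, `∫_{B_{2R}} ‖DU‖² ≤ B_E` (`B_A, B_E ≥ 0`), thresholds
`𝒜 = 48(B_A+1)/R`, `ℰ = 48(B_E+1)/R`, and a band number `J ≥ 1` admissible uniformly over `(R, 2R)`.  Then there are
`G ⊆ [R², 4R²]` measurable with `|G| ≥ R²` and a measurable `N ⊆ B_{2R}` containing every `γ`-fast point `z` with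
`‖z‖² ∈ G`, such that `|N| · ∫_N ‖U‖² ≤ (48·𝒜/(γ²R))·e^{−J/4}·B_A`.
[Chebyshev + cone Tonelli for the good radii; reverse cone Tonelli + the band law for the six tubes; six-cone cover] -/
theorem thinFastExits_structural {u u₁ u₂ : (EuclideanSpace ℝ (Fin 3))} (hon : Orthonormal ℝ ![u, u₁, u₂]) (hU : ContDiff ℝ 1 U)
    {γ R BA BE 𝒜 ℰ : ℝ} (hγ : 0 < γ) (hR : 0 < R) (hBA : 0 ≤ BA) (hBE : 0 ≤ BE)
    (hIA : ∫⁻ y in closedBall (0 : (EuclideanSpace ℝ (Fin 3))) (2 * R), ‖U y‖ₑ ^ 2 ≤ ENNReal.ofReal BA)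
    (hIE : ∫⁻ y in closedBall (0 : (EuclideanSpace ℝ (Fin 3))) (2 * R), ‖fderiv ℝ U y‖ₑ ^ 2 ≤ ENNReal.ofReal BE)
    (h𝒜d : 𝒜 = 48 * (BA + 1) / R) (hℰd : ℰ = 48 * (BE + 1) / R)
    {J : ℕ} (hJ : 0 < J) (hJA : bandConst * (J : ℝ) ^ 2 * (4 * 𝒜 / (γ ^ 2 * R ^ 2)) ≤ (R / 20) ^ 2 / 8)
    (hJE : 8 * bandConst * (J : ℝ) * (200 / 19 * (𝒜 + (2 * R) ^ 2 * ℰ)) ≤ (γ * R ^ 2 / 2) ^ 2) :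
    ∃ (G : Set ℝ) (N : Set (EuclideanSpace ℝ (Fin 3))), MeasurableSet G ∧ G ⊆ Icc (R ^ 2) ((2 * R) ^ 2) ∧
      1 * R ^ 2 ≤ (volume G).toReal ∧ MeasurableSet N ∧ N ⊆ closedBall 0 (2 * R) ∧
      (∀ z, ‖z‖ ^ 2 ∈ G → inner ℝ (U z) z + γ * ‖z‖ ^ 2 < 0 → z ∈ N) ∧
      volume N * ∫⁻ z in N, ENNReal.ofReal (‖U z‖ ^ 2) ≤
        ENNReal.ofReal (48 * 𝒜 / (γ ^ 2 * R) * Real.exp (-(J : ℝ) / 4) * BA) := by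
  have h𝒜 : 0 ≤ 𝒜 := by rw [h𝒜d]; positivity
  have hℰ : 0 ≤ ℰ := by rw [hℰd]; positivity
  -- scalar relations and the six frames
  have hu : ‖u‖ = 1 := norm_frame₀ hon
  have h1 : ‖u₁‖ = 1 := norm_frame₁ hon
  have h2 : ‖u₂‖ = 1 := norm_frame₂ hon
  have h01 : ⟪u, u₁⟫ = 0 := inner_frame₀₁ hon
  have h02 : ⟪u, u₂⟫ = 0 := inner_frame₀₂ hon
  have h12 : ⟪u₁, u₂⟫ = 0 := inner_frame₁₂ hon
  have h10 : ⟪u₁, u⟫ = 0 := (real_inner_comm u u₁).trans h01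
  have h20 : ⟪u₂, u⟫ = 0 := (real_inner_comm u u₂).trans h02
  have h21 : ⟪u₂, u₁⟫ = 0 := (real_inner_comm u₁ u₂).trans h12
  have f1 : Orthonormal ℝ ![u, u₁, u₂] := hon
  have f2 : Orthonormal ℝ ![-u, u₁, u₂] :=
    orthonormal_frame (by rw [norm_neg, hu]) h1 h2 (by rw [inner_neg_left, h01, neg_zero])
      (by rw [inner_neg_left, h02, neg_zero]) h12
  have f3 : Orthonormal ℝ ![u₁, u, u₂] := orthonormal_frame h1 hu h2 h10 h12 h02
  have f4 : Orthonormal ℝ ![-u₁, u, u₂] :=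
    orthonormal_frame (by rw [norm_neg, h1]) hu h2 (by rw [inner_neg_left, h10, neg_zero])
      (by rw [inner_neg_left, h12, neg_zero]) h02
  have f5 : Orthonormal ℝ ![u₂, u, u₁] := orthonormal_frame h2 hu h1 h20 h21 h01
  have f6 : Orthonormal ℝ ![-u₂, u, u₁] :=
    orthonormal_frame (by rw [norm_neg, h2]) hu h1 (by rw [inner_neg_left, h20, neg_zero])
      (by rw [inner_neg_left, h21, neg_zero]) h01
  -- the radii good for all six frames
  obtain ⟨T, hTd⟩ : ∃ T : Set ℝ, T = ((goodRadii u u₁ u₂ U R 𝒜 ℰ ∩ goodRadii (-u) u₁ u₂ U R 𝒜 ℰ) ∩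
      (goodRadii u₁ u u₂ U R 𝒜 ℰ ∩ goodRadii (-u₁) u u₂ U R 𝒜 ℰ)) ∩
      (goodRadii u₂ u u₁ U R 𝒜 ℰ ∩ goodRadii (-u₂) u u₁ U R 𝒜 ℰ) := ⟨_, rfl⟩
  have hTm : MeasurableSet T := by
    rw [hTd]
    exact (((measurableSet_goodRadii _ _ _ hU _ _ _).inter (measurableSet_goodRadii _ _ _ hU _ _ _)).inter
      ((measurableSet_goodRadii _ _ _ hU _ _ _).inter (measurableSet_goodRadii _ _ _ hU _ _ _))).inter
      ((measurableSet_goodRadii _ _ _ hU _ _ _).inter (measurableSet_goodRadii _ _ _ hU _ _ _))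
  have hT1 : T ⊆ goodRadii u u₁ u₂ U R 𝒜 ℰ := fun t ht => by rw [hTd] at ht; exact ht.1.1.1
  have hT2 : T ⊆ goodRadii (-u) u₁ u₂ U R 𝒜 ℰ := fun t ht => by rw [hTd] at ht; exact ht.1.1.2
  have hT3 : T ⊆ goodRadii u₁ u u₂ U R 𝒜 ℰ := fun t ht => by rw [hTd] at ht; exact ht.1.2.1
  have hT4 : T ⊆ goodRadii (-u₁) u u₂ U R 𝒜 ℰ := fun t ht => by rw [hTd] at ht; exact ht.1.2.2
  have hT5 : T ⊆ goodRadii u₂ u u₁ U R 𝒜 ℰ := fun t ht => by rw [hTd] at ht; exact ht.2.1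
  have hT6 : T ⊆ goodRadii (-u₂) u u₁ U R 𝒜 ℰ := fun t ht => by rw [hTd] at ht; exact ht.2.2
  have hTI : T ⊆ Ioo R (2 * R) := hT1.trans (goodRadii_subset _ _ _ U R 𝒜 ℰ)
  have hTpos : ∀ t ∈ T, 0 < t := fun t ht => hR.trans (hTI ht).1
  -- its measure: the bad radii of the six frames have total measure ≤ R/4
  have hbad : ∀ {a b c : (EuclideanSpace ℝ (Fin 3))}, Orthonormal ℝ ![a, b, c] →
      volume (Ioo R (2 * R) \ goodRadii a b c U R 𝒜 ℰ) ≤ ENNReal.ofReal (R / 24) := by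
    intro a b c habc
    rw [h𝒜d, hℰd]
    exact volume_Ioo_diff_goodRadii_le habc hU hR hBA hBE hIA hIE
  have hdiff : volume (Ioo R (2 * R) \ T) ≤ ENNReal.ofReal (R / 4) := by
    have hset : Ioo R (2 * R) \ T = ((Ioo R (2 * R) \ goodRadii u u₁ u₂ U R 𝒜 ℰ ∪ Ioo R (2 * R) \ goodRadii (-u) u₁ u₂ U R 𝒜 ℰ) ∪
        (Ioo R (2 * R) \ goodRadii u₁ u u₂ U R 𝒜 ℰ ∪ Ioo R (2 * R) \ goodRadii (-u₁) u u₂ U R 𝒜 ℰ)) ∪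
        (Ioo R (2 * R) \ goodRadii u₂ u u₁ U R 𝒜 ℰ ∪ Ioo R (2 * R) \ goodRadii (-u₂) u u₁ U R 𝒜 ℰ) := by
      rw [hTd]; simp only [Set.sdiff_inter]
    rw [hset]
    refine (measure_union_le _ _).trans ((add_le_add ((measure_union_le _ _).trans (add_le_add
      ((measure_union_le _ _).trans (add_le_add (hbad f1) (hbad f2)))
      ((measure_union_le _ _).trans (add_le_add (hbad f3) (hbad f4))))) ((measure_union_le _ _).trans
      (add_le_add (hbad f5) (hbad f6)))).trans (le_of_eq ?_))
    have h24 : (0 : ℝ) ≤ R / 24 := by positivity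
    rw [← ENNReal.ofReal_add h24 h24, ← ENNReal.ofReal_add (by positivity) (by positivity),
      ← ENNReal.ofReal_add (by positivity) (by positivity)]
    congr 1; ring
  have hTvol : ENNReal.ofReal (3 * R / 4) ≤ volume T := by
    have hsplit : volume (Ioo R (2 * R) ∩ T) + volume (Ioo R (2 * R) \ T) = volume (Ioo R (2 * R)) :=
      measure_inter_add_sdiff _ hTm
    rw [inter_eq_right.2 hTI, Real.volume_Ioo, show 2 * R - R = R by ring] at hsplit
    have hle : ENNReal.ofReal (3 * R / 4) + ENNReal.ofReal (R / 4) ≤ volume T + ENNReal.ofReal (R / 4) := by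
      rw [← ENNReal.ofReal_add (by positivity) (by positivity), show 3 * R / 4 + R / 4 = R by ring, ← hsplit]
      exact add_le_add le_rfl hdiff
    exact ENNReal.le_of_add_le_add_right ENNReal.ofReal_ne_top hle
  -- the squares of the good radii
  have hTIoi : T ⊆ Ioi R := fun t ht => (hTI ht).1
  obtain ⟨G, hGd⟩ : ∃ G : Set ℝ, G = (fun t : ℝ => t ^ 2) '' T := ⟨_, rfl⟩
  have hGm : MeasurableSet G := by
    rw [hGd]; exact measurableSet_image_sq hTm (hTIoi.trans (Ioi_subset_Ioi hR.le))
  have hGI : G ⊆ Icc (R ^ 2) ((2 * R) ^ 2) := by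
    rw [hGd]
    rintro _ ⟨t, ht, rfl⟩
    have h := hTI ht
    exact ⟨pow_le_pow_left₀ hR.le h.1.le 2, pow_le_pow_left₀ (hTpos t ht).le h.2.le 2⟩
  have hGvol : 1 * R ^ 2 ≤ (volume G).toReal := by
    have hfin : volume G ≠ ⊤ := ((measure_mono hGI).trans_lt measure_Icc_lt_top).ne
    rw [← ENNReal.ofReal_le_iff_le_toReal hfin]
    calc ENNReal.ofReal (1 * R ^ 2) ≤ ENNReal.ofReal (2 * R) * ENNReal.ofReal (3 * R / 4) := by
          rw [← ENNReal.ofReal_mul (by positivity)]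
          exact ENNReal.ofReal_le_ofReal (by nlinarith)
      _ ≤ ENNReal.ofReal (2 * R) * volume T := mul_le_mul' le_rfl hTvol
      _ ≤ volume G := by rw [hGd]; exact volume_image_sq_ge hTm hR hTIoi
  -- the six tubes
  obtain ⟨m1, s1, v1⟩ := tube_package f1 hU hγ hR h𝒜 hℰ hTm hT1 hJ hJA hJE
  obtain ⟨m2, s2, v2⟩ := tube_package f2 hU hγ hR h𝒜 hℰ hTm hT2 hJ hJA hJE
  obtain ⟨m3, s3, v3⟩ := tube_package f3 hU hγ hR h𝒜 hℰ hTm hT3 hJ hJA hJE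
  obtain ⟨m4, s4, v4⟩ := tube_package f4 hU hγ hR h𝒜 hℰ hTm hT4 hJ hJA hJE
  obtain ⟨m5, s5, v5⟩ := tube_package f5 hU hγ hR h𝒜 hℰ hTm hT5 hJ hJA hJE
  obtain ⟨m6, s6, v6⟩ := tube_package f6 hU hγ hR h𝒜 hℰ hTm hT6 hJ hJA hJE
  obtain ⟨N, hNd⟩ : ∃ N : Set (EuclideanSpace ℝ (Fin 3)), N = ((tube u U γ T ∪ tube (-u) U γ T) ∪
      (tube u₁ U γ T ∪ tube (-u₁) U γ T)) ∪ (tube u₂ U γ T ∪ tube (-u₂) U γ T) := ⟨_, rfl⟩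
  have hNm : MeasurableSet N := by
    rw [hNd]; exact ((m1.union m2).union (m3.union m4)).union (m5.union m6)
  have hNB : N ⊆ closedBall 0 (2 * R) := by
    rw [hNd]; exact union_subset (union_subset (union_subset s1 s2) (union_subset s3 s4)) (union_subset s5 s6)
  -- the cover
  have hcover : ∀ z, ‖z‖ ^ 2 ∈ G → inner ℝ (U z) z + γ * ‖z‖ ^ 2 < 0 → z ∈ N := by
    intro z hzG hfast
    rw [hGd] at hzG
    obtain ⟨t, htT, hts⟩ := hzG
    have ht0 := hTpos t htT
    have hzt : ‖z‖ = t := ((pow_left_inj₀ (norm_nonneg z) ht0.le two_ne_zero).1 hts.symm)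
    have hzT : ‖z‖ ∈ T := hzt ▸ htT
    have hz0 : z ≠ 0 := norm_pos_iff.1 (hzt ▸ ht0)
    have hf : z ∈ fastSet U γ := hfast
    rw [hNd]
    rcases exists_inner_sq_ge hon z with hc | hc | hc
    · exact Or.inl (Or.inl (mem_tube_or hzT hz0 hf hc))
    · exact Or.inl (Or.inr (mem_tube_or hzT hz0 hf hc))
    · exact Or.inr (mem_tube_or hzT hz0 hf hc)
  -- volume of N
  have hX0 : 0 ≤ 8 * 𝒜 / (γ ^ 2 * R) * Real.exp (-(J : ℝ) / 4) := by positivity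
  have hNvol : volume N ≤ ENNReal.ofReal (48 * 𝒜 / (γ ^ 2 * R) * Real.exp (-(J : ℝ) / 4)) := by
    rw [hNd]
    refine (measure_union_le _ _).trans ((add_le_add ((measure_union_le _ _).trans (add_le_add
      ((measure_union_le _ _).trans (add_le_add v1 v2)) ((measure_union_le _ _).trans (add_le_add v3 v4))))
      ((measure_union_le _ _).trans (add_le_add v5 v6))).trans (le_of_eq ?_))
    rw [← ENNReal.ofReal_add hX0 hX0, ← ENNReal.ofReal_add (by positivity) (by positivity),
      ← ENNReal.ofReal_add (by positivity) (by positivity)]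
    congr 1; ring
  -- energy on N
  have hNint : ∫⁻ z in N, ENNReal.ofReal (‖U z‖ ^ 2) ≤ ENNReal.ofReal BA := by
    calc ∫⁻ z in N, ENNReal.ofReal (‖U z‖ ^ 2) = ∫⁻ z in N, ‖U z‖ₑ ^ 2 := by
          refine lintegral_congr fun z => ?_; rw [Literature.Analysis.FluidPDE.enorm_sq_eq_ofReal_norm_sq]
      _ ≤ ∫⁻ z in closedBall (0 : (EuclideanSpace ℝ (Fin 3))) (2 * R), ‖U z‖ₑ ^ 2 := lintegral_mono_set hNB
      _ ≤ ENNReal.ofReal BA := hIA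
  refine ⟨G, N, hGm, hGI, hGvol, hNm, hNB, hcover, ?_⟩
  calc volume N * ∫⁻ z in N, ENNReal.ofReal (‖U z‖ ^ 2)
      ≤ ENNReal.ofReal (48 * 𝒜 / (γ ^ 2 * R) * Real.exp (-(J : ℝ) / 4)) * ENNReal.ofReal BA := mul_le_mul' hNvol hNint
    _ = ENNReal.ofReal (48 * 𝒜 / (γ ^ 2 * R) * Real.exp (-(J : ℝ) / 4) * BA) := by
        rw [← ENNReal.ofReal_mul (by positivity)]

end Summit.NavierStokesRegularity.NavierStokesRegularity.Theorems.PowerGaugeEulerLiouville.NeedleFastSetMeasure
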